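import Summits.CriticalPhenomena.CardyFormulaZ2.Theses.CardyMagicRigidity
import Literature.Probability.RandomPlanarGeometry.NestingTransform
import Literature.Probability.Percolation.ArmEvents

/-!
# Sketch — crux-ideate stmt-CriticalPhenomena-4833 (LoopLimitZ2EqT), ideator 1, round 1 (gen 2)

Card `charge-periodicity-radial-pin`.  Typed objects (NOT proved here; sorries only in the two
announced lemmas of the line):

* `radialCount c r R` — number of loops of a typed configuration `c` surrounding the closed ball
  `B̄(0,r)` and contained in the open ball `B(0,R)` (the RADIAL sector of DKKMO's `d_CN`, cf. the
  disprover's `not_isClose_of_unmatched_big_loop` / `bigLoop_mass_lt`).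
* `radialGF w n N` — the bond-ℤ² radial nesting generating function `E_{1/2}[w ^ N(n, N)]` at mesh 1.
* `eSix` — SSW's CLE₆ radial nesting exponent written in the CHARGE variable `Q`
  (`w = 2cos(Q + π/3)`): `eSix Q = 3Q²/(4π²) + Q/(2π)`; in the weight variable this is
  `¾(θ² − 1/9)`, `w = 2cos(πθ)`; `eSix (π/6) = 5/48` (the `w → 0⁺` endpoint = one-arm exponent).
* `RadialExponentLawZ2` — the radial sector of `X`: for every `w ∈ (0,2)` the bond-ℤ² radial
  generating function has decay exponent `eSix (arccos(w/2) − π/3)` (= SSW's value on `𝕋`/CLE₆).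
* `radial_sector` — THE LINE'S MAIN LEMMA (sorried): `MagicFormulaZ2 → RadialExponentLawZ2`.
* `radialGauge_pin` — THE LEVER, pure real analysis (sorried here, provable now): quadratic
  Gaussian growth + additivity of the reduced exponent (from concentric multi-annulus test functions
  and exact independence) + the trivial reflection symmetry `w(Q) = w(−2π/3 − Q)` of the cosine
  weight force `e = eSix` on the positive-weight cone `(−5π/6, π/6)`.
* `oneArm_of_radial` — the headline by-product as a typed target (sorried): the radial law gives the
  one-arm exponent `5/48` of bond percolation on `ℤ²` (`HasOneArmExponent (oneArmProb 2 half) (5/48)`).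
-/

noncomputable section

namespace Summit.CriticalPhenomena.CardyFormulaZ2.Cruxes.LoopLimitZ2EqT.IdeatorOneG2

open MeasureTheory Filter Set Real
open scoped Topology ENNReal
open Literature.Probability.RandomPlanarGeometry
open Literature.Probability.Percolation Literature.Probability.LatticeModels
open Summit.CriticalPhenomena.CardyFormulaZ2.Theses.CardyMagicRigidity (LoopLimitZ2EqT MagicFormulaZ2)

/-- Number of loops (of either type) of the configuration `c` that surround the closed ball
`B̄(0,r)` (non-zero winding number about every point of it) and whose trace lies in `B(0,R)`
(`Set.ncard`, `0` for an infinite family — never the case for lattice configurations). -/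
def radialCount (c : LoopConfig ℂ) (r R : ℝ) : ℕ :=
  Set.ncard {u ∈ c.loops | (∀ z ∈ Metric.closedBall (0 : ℂ) r, u.wind z ≠ 0) ∧ u.range ⊆ Metric.ball 0 R}

/-- The bond-ℤ² radial nesting generating function at mesh `1`:
`Z(w; n, N) = E_{1/2}[w ^ #{interface loops surrounding B̄(0,n) inside B(0,N)}]`. -/
def radialGF (w : ℝ) (n N : ℕ) : ℝ :=
  ∫ ω, w ^ radialCount (bondLoopConfig 1 0 ω) n N ∂(bondPercolation (zdGraph 2) half)

/-- SSW's CLE₆ radial nesting exponent in the charge variable `Q` (`w = 2cos(Q + π/3)`):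
`e₆(Q) = 3Q²/(4π²) + Q/(2π)` — the quadratic part is the DKLM Gaussian exponent `σ²Q²/(4π)` with
`σ² = 3/π`, the linear part is `√3 ×` (hull density per e-fold `1/(2π√3)`). -/
def eSix (Q : ℝ) : ℝ := 3 * Q ^ 2 / (4 * π ^ 2) + Q / (2 * π)

/-- Sanity: the `w → 0⁺` endpoint of the cone, `Q = π/6`, is the one-arm exponent `5/48`. -/
theorem eSix_pi_div_six : eSix (π / 6) = 5 / 48 := by
  unfold eSix
  have hπ : π ≠ 0 := Real.pi_ne_zero
  field_simp
  ring

/-- Sanity: `w = 1` is reached at `Q = 0` AND at `Q = −2π/3`; the exponent vanishes at both. -/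
theorem eSix_neg_two_pi_div_three : eSix (-(2 * π / 3)) = 0 := by
  unfold eSix
  have hπ : π ≠ 0 := Real.pi_ne_zero
  field_simp
  ring

/-- Sanity: `eSix` is invariant under the reflection `Q ↦ −2π/3 − Q` that fixes the weight
`2cos(Q + π/3)` — the identity that PINS the linear gauge. -/
theorem eSix_reflect (Q : ℝ) : eSix (-(2 * π / 3) - Q) = eSix Q := by
  unfold eSix
  have hπ : π ≠ 0 := Real.pi_ne_zero
  field_simp
  ring

/-- **The radial sector of `X` (typed).** For every weight `w ∈ (0,2)` there is an inner radius
`n₀` such that the bond-ℤ² radial generating function `N ↦ Z(w; n₀, N)` has logarithmic decay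
exponent `e₆(arccos(w/2) − π/3)` (SSW's CLE₆ value; `HasDecayExponent u κ : log (u N)/log N → −κ`;
negative `κ` for `w ∈ (1,2)` = growth). On `𝕋` the same statement is a theorem-grade consequence of
Camia–Newman + Schramm–Sheffield–Wilson. -/
def RadialExponentLawZ2 : Prop :=
  ∀ w ∈ Set.Ioo (0 : ℝ) 2, ∃ n₀ : ℕ,
    HasDecayExponent (fun N : ℕ ↦ radialGF w n₀ N) (eSix (Real.arccos (w / 2) - π / 3))

/-- **Main lemma of the line (NOT proved here).** The route's rank-2 input alone — DKLM's magic
formula on `ℤ²`, fed with concentric multi-annulus test functions whose charges stay in the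
positive-weight cone — pins the entire radial nesting exponent function of bond-`ℤ²`. -/
theorem radial_sector : MagicFormulaZ2 → RadialExponentLawZ2 := by
  sorry

/-- **The lever, as pure real analysis (provable now; sorried in this sketch).**
Let `e : ℝ → ℝ` (the radial exponent in the charge variable) satisfy, on the positive-weight cone
`C = (−5π/6, π/6)`:
* `hw`   — `e` depends on the charge only through the weight `2cos(Q + π/3)`:
           `e Q = e (−2π/3 − Q)`;
* `hadd` — additivity of the reduced exponent `ẽ(Q) = e(Q) − 3Q²/(4π²)` under small positive
           increments inside the cone (the exponent bookkeeping of DKLM's identity for CONCENTRIC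
           charged annuli: Gaussian side quadratic in the enclosed charge, boundary-layer exponents
           independent of the enclosed charge by exact independence);
* `h0`   — `e 0 = 0` (weight `1`);
* `hbdd` — `e` is bounded above on `[0, π/12]` (monotonicity in the weight gives this for free).
Then `e = eSix` on the cone: additivity makes `ẽ` linear, `ẽ(Q) = λQ`, and `hw` at the pair
`(Q, −2π/3 − Q)` forces `λ = 1/(2π)` (coefficient AND constant term agree — the consistency check). -/
theorem radialGauge_pin (e : ℝ → ℝ)
    (hw : ∀ Q, e Q = e (-(2 * π / 3) - Q))
    (hadd : ∀ Q c, Q ∈ Set.Ioo (-(5 * π / 6)) (π / 6) → c ∈ Set.Ioo 0 (π / 6) →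
      Q + c ∈ Set.Ioo (-(5 * π / 6)) (π / 6) →
        e (Q + c) - 3 * (Q + c) ^ 2 / (4 * π ^ 2) =
          (e Q - 3 * Q ^ 2 / (4 * π ^ 2)) + (e c - 3 * c ^ 2 / (4 * π ^ 2)))
    (h0 : e 0 = 0)
    (hbdd : BddAbove (e '' Set.Icc 0 (π / 12))) :
    ∀ Q ∈ Set.Ioo (-(5 * π / 6)) (π / 6), e Q = eSix Q := by
  sorry

/-- **Headline by-product as a typed target (NOT proved here):** the radial law yields existence
and value `5/48` of the one-arm exponent of critical bond percolation on `ℤ²` (`w → 0⁺` endpoint of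
the cone + "few surrounding loops cost as much as none" + `{N(n,N) = 0} ≍ {one arm}` by planarity;
announced independently as [alpha1] in arXiv:2603.06268 §3.1). -/
theorem oneArm_of_radial : RadialExponentLawZ2 → HasOneArmExponent (oneArmProb 2 half) (5 / 48) := by
  sorry

/-- Exact submultiplicativity, the first lattice step (statement only, provable now from
independence of disjoint edge sets + superadditivity of the radial count:
`N(n,N) ≥ N(n,m) + N(m,N)` and the two summands are functions of the edges inside `B(0,m)` and
inside `B(0,N) \ B̄(0,m)` respectively). -/
def RadialSubmult : Prop :=
  ∀ w ∈ Set.Ioc (0 : ℝ) 1, ∀ n m N : ℕ, n ≤ m → m ≤ N →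
    radialGF w n N ≤ radialGF w n m * radialGF w m N

end Summit.CriticalPhenomena.CardyFormulaZ2.Cruxes.LoopLimitZ2EqT.IdeatorOneG2

end
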